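import Summits.Ventures.LatticeQCDFlow.Exactness.IMHCoupledEstimatorReplicas
import Summits.Ventures.LatticeQCDFlow.Exactness.IMHCommonRandomNumbersMergedForever
import HarnessLib

/-!
# The exactly unbiased coupled flow-MCMC estimator `H_k = f(Y_k) + Σ_{n≥k}(f(X′_n) − f(Y_n))` is a finite sum on almost every pair
# path and has finite variance `Var(H_k) = E(H_k − π f)² ≤ Var_π f + (1 − A)^k(c − a)²(2W² + W + 1)`

HONEST FRAMING: exact (Metropolis-corrected) sampling algorithms for lattice gauge theory;
figures of merit are autocorrelation/cost numbers at stated couplings and volumes; no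
continuum-physics claim.

Venture `LatticeQCDFlow` (cell pub-lqcd), topic `Exactness`; FANOUT row 30 (lean-1, GEN-38).  NEW WORK of the cell,
general state space with `MeasurableEq Ω`; sequel to GEN-36's `Exactness/IMHCoupledUnbiasedEstimator` (the lag-one
common-random-numbers pair chain of `K = indepMH q w` — first run one update ahead — makes `H_k = f(Y_k) + Σ_{n≥k} D_n`,
`D_n = f(X′_n) − f(Y_n)`, EXACTLY UNBIASED for `π f`, with `E[Σ D] = Σ E D`; «NOT CLAIMED: the variance of `H_k` (finite; not
computed)»), GEN-37's `Exactness/IMHCoupledUnbiasedEstimatorMSE` (the TRUNCATED estimator `H_{k,N} = f(Y_k) + Σ_{n<N} D_{k+n}`: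
`E(H_{k,N} − π f)² ≤ Var_π f + r^k(c − a)²(2W² + W + 1)` uniformly in `N`, `W = w(x₀)`, `r = 1 − 1/W`) and this generation's
`Exactness/IMHCommonRandomNumbersMergedForever` (almost surely the two runs coincide forever from some time on).  Here the
untruncated estimator itself (`N = ∞`, Mathlib's `tsum` along the path):

* §1 **`crnLag_ae_corrections_eventually_zero`** — almost surely the corrections vanish from some index on;
  **`crnLag_ae_summable_corrections`** — so `n ↦ D_{k+n}` is summable on almost every pair path (a FINITE sum), and
  **`crnLag_ae_tendsto_truncated`** ∕ **`crnLag_ae_tendsto_estimator`** — the truncated estimators converge to `H_k` along almost every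
  path, so `H_k` is a.e.-strongly measurable (**`crnLag_untruncated_aestronglyMeasurable`**).
* §2 **`crnLag_untruncated_sq_le`** — FATOU: `E(H_k − π f)² ≤ Var_π f + r^k(c − a)²(2W² + W + 1)` from every initial coupling one
  update ahead (the uniform-in-`N` bound of GEN-37 passes to the limit), with **`crnLag_untruncated_sq_integrable`** — `H_k − π f`
  is square integrable; **`crnLag_untruncated_variance_le`** — since `E H_k = π f` EXACTLY (GEN-36), `Var(H_k) = E(H_k − π f)²
  ≤ Var_π f + r^k(c − a)²(2W² + W + 1)` and **`crnLag_untruncated_memLp_two`** (`H_k ∈ L²`): THE EXACTLY UNBIASED ESTIMATOR HAS FINITE VARIANCE — ONE EQUILIBRIUM DRAW'S PLUS A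
  GEOMETRICALLY SMALL LAG TERM — so `R` independent copies carry an honest `1/√R` error bar with no bias floor at all
  (this generation's `Exactness/IMHCoupledEstimatorErrorBar` for the truncated version).
Reading (gauge files): the burn-in-free estimator of two exact gauge runs on one stream of random numbers is, on almost every
run, a finite sum; its variance is at most `Var_π f + (1 − A)^k(c − a)²(2/A² + 1/A + 1)`.
NOT CLAIMED: the exact variance; a lower bound at `N = ∞` (GEN-37 `IMHCoupledEstimatorEfficiency` gives the two-sided statement
for every finite `N`); the central limit theorem across replicas; anything for unbounded `f` or any value of `A`.  No `sorry`,
no new definitions, nothing cited as a fact.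
-/

noncomputable section

namespace Summit.Ventures.LatticeQCDFlow.Exactness

open MeasureTheory ProbabilityTheory Function Finset Filter
open scoped ENNReal unitInterval Topology
open Summit.Ventures.LatticeQCDFlow.Scoring

variable {Ω : Type*} [MeasurableSpace Ω] {q : Measure Ω} [IsProbabilityMeasure q] {w : Ω → ℝ}

/-! ## §1 On almost every pair path the estimator is a finite sum -/

/-- **ALMOST SURELY THE CORRECTIONS VANISH FROM SOME INDEX ON**: `P̂`-a.e. pair path has `∃ n₀, ∀ n ≥ n₀,
f((z(k+n)).1) − f((z(k+n)).2) = 0` (`w` normalised, maximal at `x₀`; `MeasurableEq Ω`). [ours] -/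
theorem crnLag_ae_corrections_eventually_zero [MeasurableEq Ω] (hw : Measurable w) (hw0 : ∀ y, 0 < w y) {x₀ : Ω}
    (hmax : ∀ y, w y ≤ w x₀) [IsProbabilityMeasure (q.withDensity fun y => ENNReal.ofReal (w y))]
    (Khat : Kernel (Ω × Ω) (Ω × Ω)) [IsMarkovKernel Khat]
    (hK : ∀ z : Ω × Ω, Khat z = (q.prod (volume : Measure unitInterval)).map (fun p : Ω × unitInterval =>
      ((if (p.2 : ℝ) * w z.1 ≤ w p.1 then p.1 else z.1), (if (p.2 : ℝ) * w z.2 ≤ w p.1 then p.1 else z.2))))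
    (μ₀ : Measure (Ω × Ω)) [IsProbabilityMeasure μ₀] (f : Ω → ℝ) (k : ℕ) :
    ∀ᵐ z ∂(Kernel.trajMeasure (X := fun _ : ℕ => Ω × Ω) μ₀
        (fun n : ℕ => Khat.comap (fun h : (i : ↥(Finset.Iic n)) → Ω × Ω => h ⟨n, Finset.mem_Iic.2 le_rfl⟩)
          (measurable_pi_apply _))),
      ∃ n₀, ∀ n, n₀ ≤ n → f ((z (k + n)).1) - f ((z (k + n)).2) = 0 := by
  filter_upwards [crn_chain_ae_eventually_merged hw hw0 hmax Khat hK μ₀] with z hz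
  obtain ⟨n₀, hn₀⟩ := hz
  refine ⟨n₀, fun n hn => ?_⟩
  rw [hn₀ (k + n) (hn.trans (Nat.le_add_left n k)), sub_self]

/-- **ALMOST SURELY THE SERIES OF CORRECTIONS IS A FINITE SUM**: `n ↦ f((z(k+n)).1) − f((z(k+n)).2)` is summable on `P̂`-a.e.
pair path. [ours] -/
theorem crnLag_ae_summable_corrections [MeasurableEq Ω] (hw : Measurable w) (hw0 : ∀ y, 0 < w y) {x₀ : Ω}
    (hmax : ∀ y, w y ≤ w x₀) [IsProbabilityMeasure (q.withDensity fun y => ENNReal.ofReal (w y))]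
    (Khat : Kernel (Ω × Ω) (Ω × Ω)) [IsMarkovKernel Khat]
    (hK : ∀ z : Ω × Ω, Khat z = (q.prod (volume : Measure unitInterval)).map (fun p : Ω × unitInterval =>
      ((if (p.2 : ℝ) * w z.1 ≤ w p.1 then p.1 else z.1), (if (p.2 : ℝ) * w z.2 ≤ w p.1 then p.1 else z.2))))
    (μ₀ : Measure (Ω × Ω)) [IsProbabilityMeasure μ₀] (f : Ω → ℝ) (k : ℕ) :
    ∀ᵐ z ∂(Kernel.trajMeasure (X := fun _ : ℕ => Ω × Ω) μ₀
        (fun n : ℕ => Khat.comap (fun h : (i : ↥(Finset.Iic n)) → Ω × Ω => h ⟨n, Finset.mem_Iic.2 le_rfl⟩)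
          (measurable_pi_apply _))),
      Summable (fun n => f ((z (k + n)).1) - f ((z (k + n)).2)) := by
  filter_upwards [crnLag_ae_corrections_eventually_zero hw hw0 hmax Khat hK μ₀ f k] with z hz
  obtain ⟨n₀, hn₀⟩ := hz
  refine summable_of_ne_finset_zero (s := Finset.range n₀) fun n hn => ?_
  exact hn₀ n (Nat.le_of_not_lt fun h => hn (Finset.mem_range.2 h))

/-- **THE TRUNCATED ESTIMATORS CONVERGE TO `H_k` ALONG ALMOST EVERY PATH.** [ours] -/
theorem crnLag_ae_tendsto_truncated [MeasurableEq Ω] (hw : Measurable w) (hw0 : ∀ y, 0 < w y) {x₀ : Ω}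
    (hmax : ∀ y, w y ≤ w x₀) [IsProbabilityMeasure (q.withDensity fun y => ENNReal.ofReal (w y))]
    (Khat : Kernel (Ω × Ω) (Ω × Ω)) [IsMarkovKernel Khat]
    (hK : ∀ z : Ω × Ω, Khat z = (q.prod (volume : Measure unitInterval)).map (fun p : Ω × unitInterval =>
      ((if (p.2 : ℝ) * w z.1 ≤ w p.1 then p.1 else z.1), (if (p.2 : ℝ) * w z.2 ≤ w p.1 then p.1 else z.2))))
    (μ₀ : Measure (Ω × Ω)) [IsProbabilityMeasure μ₀] (f : Ω → ℝ) (k : ℕ) (m : ℝ) :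
    ∀ᵐ z ∂(Kernel.trajMeasure (X := fun _ : ℕ => Ω × Ω) μ₀
        (fun n : ℕ => Khat.comap (fun h : (i : ↥(Finset.Iic n)) → Ω × Ω => h ⟨n, Finset.mem_Iic.2 le_rfl⟩)
          (measurable_pi_apply _))),
      Tendsto (fun N => (f ((z k).2) + ∑ n ∈ Finset.range N, (f ((z (k + n)).1) - f ((z (k + n)).2)) - m) ^ 2) atTop
        (𝓝 ((f ((z k).2) + ∑' n, (f ((z (k + n)).1) - f ((z (k + n)).2)) - m) ^ 2)) := by
  filter_upwards [crnLag_ae_summable_corrections hw hw0 hmax Khat hK μ₀ f k] with z hz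
  have h := hz.hasSum.tendsto_sum_nat
  exact ((tendsto_const_nhds.add h).sub tendsto_const_nhds).pow 2

/-- **THE TRUNCATED ESTIMATORS THEMSELVES CONVERGE TO `H_k` ALONG ALMOST EVERY PATH** (unsquared form). [ours] -/
theorem crnLag_ae_tendsto_estimator [MeasurableEq Ω] (hw : Measurable w) (hw0 : ∀ y, 0 < w y) {x₀ : Ω}
    (hmax : ∀ y, w y ≤ w x₀) [IsProbabilityMeasure (q.withDensity fun y => ENNReal.ofReal (w y))]
    (Khat : Kernel (Ω × Ω) (Ω × Ω)) [IsMarkovKernel Khat]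
    (hK : ∀ z : Ω × Ω, Khat z = (q.prod (volume : Measure unitInterval)).map (fun p : Ω × unitInterval =>
      ((if (p.2 : ℝ) * w z.1 ≤ w p.1 then p.1 else z.1), (if (p.2 : ℝ) * w z.2 ≤ w p.1 then p.1 else z.2))))
    (μ₀ : Measure (Ω × Ω)) [IsProbabilityMeasure μ₀] (f : Ω → ℝ) (k : ℕ) :
    ∀ᵐ z ∂(Kernel.trajMeasure (X := fun _ : ℕ => Ω × Ω) μ₀
        (fun n : ℕ => Khat.comap (fun h : (i : ↥(Finset.Iic n)) → Ω × Ω => h ⟨n, Finset.mem_Iic.2 le_rfl⟩)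
          (measurable_pi_apply _))),
      Tendsto (fun N => f ((z k).2) + ∑ n ∈ Finset.range N, (f ((z (k + n)).1) - f ((z (k + n)).2))) atTop
        (𝓝 (f ((z k).2) + ∑' n, (f ((z (k + n)).1) - f ((z (k + n)).2)))) := by
  filter_upwards [crnLag_ae_summable_corrections hw hw0 hmax Khat hK μ₀ f k] with z hz
  exact tendsto_const_nhds.add hz.hasSum.tendsto_sum_nat

/-- **THE UNTRUNCATED ESTIMATOR IS A.E.-STRONGLY MEASURABLE** on pair-path space (an a.e. limit of the measurable truncations).
[ours, bookkeeping] -/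
theorem crnLag_untruncated_aestronglyMeasurable [MeasurableEq Ω] (hw : Measurable w) (hw0 : ∀ y, 0 < w y) {x₀ : Ω}
    (hmax : ∀ y, w y ≤ w x₀) [IsProbabilityMeasure (q.withDensity fun y => ENNReal.ofReal (w y))]
    (Khat : Kernel (Ω × Ω) (Ω × Ω)) [IsMarkovKernel Khat]
    (hK : ∀ z : Ω × Ω, Khat z = (q.prod (volume : Measure unitInterval)).map (fun p : Ω × unitInterval =>
      ((if (p.2 : ℝ) * w z.1 ≤ w p.1 then p.1 else z.1), (if (p.2 : ℝ) * w z.2 ≤ w p.1 then p.1 else z.2))))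
    (μ₀ : Measure (Ω × Ω)) [IsProbabilityMeasure μ₀] {f : Ω → ℝ} (hf : Measurable f) (k : ℕ) :
    AEStronglyMeasurable (fun z : ℕ → Ω × Ω => f ((z k).2) + ∑' n, (f ((z (k + n)).1) - f ((z (k + n)).2)))
      (Kernel.trajMeasure (X := fun _ : ℕ => Ω × Ω) μ₀
        (fun n : ℕ => Khat.comap (fun h : (i : ↥(Finset.Iic n)) → Ω × Ω => h ⟨n, Finset.mem_Iic.2 le_rfl⟩)
          (measurable_pi_apply _))) :=
  aestronglyMeasurable_of_tendsto_ae atTop (fun N => (measurable_crnLagEstimator hf k N).aestronglyMeasurable)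
    (crnLag_ae_tendsto_estimator hw hw0 hmax Khat hK μ₀ f k)

/-! ## §2 Fatou: the untruncated estimator is square integrable with the uniform bound of the truncations -/

/-- **`∫⁻ (H_k − π f)² ≤ Var_π f + r^k(c − a)²(2W² + W + 1)`** (extended-real form, Fatou along the truncations). [ours] -/
theorem crnLag_untruncated_lintegral_sq_le [MeasurableEq Ω] [Fact (Measurable w)] (hw0 : ∀ y, 0 < w y) {x₀ : Ω}
    (hmax : ∀ y, w y ≤ w x₀) [IsProbabilityMeasure (q.withDensity fun y => ENNReal.ofReal (w y))]
    (Khat : Kernel (Ω × Ω) (Ω × Ω)) [IsMarkovKernel Khat]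
    (hK : ∀ z : Ω × Ω, Khat z = (q.prod (volume : Measure unitInterval)).map (fun p : Ω × unitInterval =>
      ((if (p.2 : ℝ) * w z.1 ≤ w p.1 then p.1 else z.1), (if (p.2 : ℝ) * w z.2 ≤ w p.1 then p.1 else z.2))))
    (μ₀ : Measure (Ω × Ω)) [IsProbabilityMeasure μ₀] {f : Ω → ℝ} (hf : Measurable f) {a c : ℝ}
    (ha : ∀ x, a ≤ f x) (hc : ∀ x, f x ≤ c) (k : ℕ) :
    ∫⁻ z, ENNReal.ofReal ((f ((z k).2) + ∑' n, (f ((z (k + n)).1) - f ((z (k + n)).2)) -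
          ∫ x, f x ∂(q.withDensity fun y => ENNReal.ofReal (w y))) ^ 2)
        ∂(Kernel.trajMeasure (X := fun _ : ℕ => Ω × Ω) μ₀
          (fun n : ℕ => Khat.comap (fun h : (i : ↥(Finset.Iic n)) → Ω × Ω => h ⟨n, Finset.mem_Iic.2 le_rfl⟩)
            (measurable_pi_apply _))) ≤
      ENNReal.ofReal (∫ y, (f y - ∫ x, f x ∂(q.withDensity fun y => ENNReal.ofReal (w y))) ^ 2
          ∂(q.withDensity fun y => ENNReal.ofReal (w y)) +
        (1 - (w x₀)⁻¹) ^ k * (c - a) ^ 2 * (2 * w x₀ ^ 2 + w x₀ + 1)) := by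
  set P := Kernel.trajMeasure (X := fun _ : ℕ => Ω × Ω) μ₀
      (fun n : ℕ => Khat.comap (fun h : (i : ↥(Finset.Iic n)) → Ω × Ω => h ⟨n, Finset.mem_Iic.2 le_rfl⟩)
        (measurable_pi_apply _)) with hP
  set m := ∫ x, f x ∂(q.withDensity fun y => ENNReal.ofReal (w y)) with hm
  set B := ∫ y, (f y - m) ^ 2 ∂(q.withDensity fun y => ENNReal.ofReal (w y)) +
    (1 - (w x₀)⁻¹) ^ k * (c - a) ^ 2 * (2 * w x₀ ^ 2 + w x₀ + 1) with hB
  have hw : Measurable w := Fact.out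
  -- the truncations: measurable, bounded, with second moment `≤ B`
  have hTm : ∀ N, Measurable fun z : ℕ → Ω × Ω =>
      (f ((z k).2) + ∑ n ∈ Finset.range N, (f ((z (k + n)).1) - f ((z (k + n)).2)) - m) ^ 2 := fun N =>
    ((measurable_crnLagEstimator hf k N).sub measurable_const).pow_const 2
  have hTb : ∀ N (z : ℕ → Ω × Ω), |(f ((z k).2) + ∑ n ∈ Finset.range N, (f ((z (k + n)).1) - f ((z (k + n)).2)) - m) ^ 2|
      ≤ (max |a| |c| + N * (c - a) + |m|) ^ 2 := by
    intro N z
    rw [abs_of_nonneg (sq_nonneg _), ← sq_abs]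
    refine pow_le_pow_left₀ (abs_nonneg _) ((abs_sub _ _).trans (add_le_add ?_ le_rfl)) 2
    exact abs_crnLagEstimator_le ha hc k N z
  have hTi : ∀ N, Integrable (fun z : ℕ → Ω × Ω =>
      (f ((z k).2) + ∑ n ∈ Finset.range N, (f ((z (k + n)).1) - f ((z (k + n)).2)) - m) ^ 2) P := fun N =>
    integrable_of_bounded P (hTm N) (hTb N)
  have hTle : ∀ N, ∫ z, (f ((z k).2) + ∑ n ∈ Finset.range N, (f ((z (k + n)).1) - f ((z (k + n)).2)) - m) ^ 2 ∂P ≤ B :=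
    fun N => crnLag_truncated_sq_le_variance' hw0 hmax Khat hK μ₀ hf ha hc k N
  -- a.e. the integrand is the limit (hence the liminf) of the truncations
  have hae : ∀ᵐ z ∂P, ENNReal.ofReal ((f ((z k).2) + ∑' n, (f ((z (k + n)).1) - f ((z (k + n)).2)) - m) ^ 2) =
      liminf (fun N => ENNReal.ofReal
        ((f ((z k).2) + ∑ n ∈ Finset.range N, (f ((z (k + n)).1) - f ((z (k + n)).2)) - m) ^ 2)) atTop := by
    filter_upwards [crnLag_ae_tendsto_truncated hw hw0 hmax Khat hK μ₀ f k m] with z hz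
    exact ((ENNReal.continuous_ofReal.tendsto _).comp hz).liminf_eq.symm
  rw [lintegral_congr_ae hae]
  refine (lintegral_liminf_le fun N => ENNReal.measurable_ofReal.comp (hTm N)).trans ?_
  refine liminf_le_of_frequently_le' (Frequently.of_forall fun N => ?_)
  show ∫⁻ z, ENNReal.ofReal ((f ((z k).2) + ∑ n ∈ Finset.range N, (f ((z (k + n)).1) - f ((z (k + n)).2)) - m) ^ 2) ∂P
    ≤ ENNReal.ofReal B
  rw [← ofReal_integral_eq_lintegral_ofReal (hTi N) (ae_of_all _ fun z => sq_nonneg _)]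
  exact ENNReal.ofReal_le_ofReal (hTle N)

/-- **THE UNTRUNCATED ESTIMATOR IS SQUARE INTEGRABLE** about `π f`, from every initial coupling. [ours] -/
theorem crnLag_untruncated_sq_integrable [MeasurableEq Ω] [Fact (Measurable w)] (hw0 : ∀ y, 0 < w y) {x₀ : Ω}
    (hmax : ∀ y, w y ≤ w x₀) [IsProbabilityMeasure (q.withDensity fun y => ENNReal.ofReal (w y))]
    (Khat : Kernel (Ω × Ω) (Ω × Ω)) [IsMarkovKernel Khat]
    (hK : ∀ z : Ω × Ω, Khat z = (q.prod (volume : Measure unitInterval)).map (fun p : Ω × unitInterval =>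
      ((if (p.2 : ℝ) * w z.1 ≤ w p.1 then p.1 else z.1), (if (p.2 : ℝ) * w z.2 ≤ w p.1 then p.1 else z.2))))
    (μ₀ : Measure (Ω × Ω)) [IsProbabilityMeasure μ₀] {f : Ω → ℝ} (hf : Measurable f) {a c : ℝ}
    (ha : ∀ x, a ≤ f x) (hc : ∀ x, f x ≤ c) (k : ℕ) :
    Integrable (fun z : ℕ → Ω × Ω => (f ((z k).2) + ∑' n, (f ((z (k + n)).1) - f ((z (k + n)).2)) -
        ∫ x, f x ∂(q.withDensity fun y => ENNReal.ofReal (w y))) ^ 2)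
      (Kernel.trajMeasure (X := fun _ : ℕ => Ω × Ω) μ₀
        (fun n : ℕ => Khat.comap (fun h : (i : ↥(Finset.Iic n)) → Ω × Ω => h ⟨n, Finset.mem_Iic.2 le_rfl⟩)
          (measurable_pi_apply _))) := by
  set P := Kernel.trajMeasure (X := fun _ : ℕ => Ω × Ω) μ₀
      (fun n : ℕ => Khat.comap (fun h : (i : ↥(Finset.Iic n)) → Ω × Ω => h ⟨n, Finset.mem_Iic.2 le_rfl⟩)
        (measurable_pi_apply _)) with hP
  set m := ∫ x, f x ∂(q.withDensity fun y => ENNReal.ofReal (w y)) with hm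
  have hw : Measurable w := Fact.out
  have hTm : ∀ N, Measurable fun z : ℕ → Ω × Ω =>
      (f ((z k).2) + ∑ n ∈ Finset.range N, (f ((z (k + n)).1) - f ((z (k + n)).2)) - m) ^ 2 := fun N =>
    ((measurable_crnLagEstimator hf k N).sub measurable_const).pow_const 2
  -- a.e.-strong measurability as an a.e. limit of the truncations
  have hasm : AEStronglyMeasurable (fun z : ℕ → Ω × Ω =>
      (f ((z k).2) + ∑' n, (f ((z (k + n)).1) - f ((z (k + n)).2)) - m) ^ 2) P :=
    aestronglyMeasurable_of_tendsto_ae atTop (fun N => (hTm N).aestronglyMeasurable)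
      (crnLag_ae_tendsto_truncated hw hw0 hmax Khat hK μ₀ f k m)
  refine ⟨hasm, ?_⟩
  rw [hasFiniteIntegral_iff_ofReal (ae_of_all _ fun z => sq_nonneg _)]
  exact (crnLag_untruncated_lintegral_sq_le hw0 hmax Khat hK μ₀ hf ha hc k).trans_lt ENNReal.ofReal_lt_top

/-- **FATOU FOR THE COUPLED ESTIMATOR**: `E(H_k − π f)² ≤ Var_π f + r^k(c − a)²(2W² + W + 1)` for the UNTRUNCATED estimator
`H_k = f(Y_k) + Σ_{n≥0}(f(X′_{k+n}) − f(Y_{k+n}))`, from every initial coupling (`w` measurable as a `Fact`, normalised, maximal at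
`x₀`; `MeasurableEq Ω`). [ours] -/
theorem crnLag_untruncated_sq_le [MeasurableEq Ω] [Fact (Measurable w)] (hw0 : ∀ y, 0 < w y) {x₀ : Ω}
    (hmax : ∀ y, w y ≤ w x₀) [IsProbabilityMeasure (q.withDensity fun y => ENNReal.ofReal (w y))]
    (Khat : Kernel (Ω × Ω) (Ω × Ω)) [IsMarkovKernel Khat]
    (hK : ∀ z : Ω × Ω, Khat z = (q.prod (volume : Measure unitInterval)).map (fun p : Ω × unitInterval =>
      ((if (p.2 : ℝ) * w z.1 ≤ w p.1 then p.1 else z.1), (if (p.2 : ℝ) * w z.2 ≤ w p.1 then p.1 else z.2))))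
    (μ₀ : Measure (Ω × Ω)) [IsProbabilityMeasure μ₀] {f : Ω → ℝ} (hf : Measurable f) {a c : ℝ}
    (ha : ∀ x, a ≤ f x) (hc : ∀ x, f x ≤ c) (k : ℕ) :
    ∫ z, (f ((z k).2) + ∑' n, (f ((z (k + n)).1) - f ((z (k + n)).2)) -
          ∫ x, f x ∂(q.withDensity fun y => ENNReal.ofReal (w y))) ^ 2
        ∂(Kernel.trajMeasure (X := fun _ : ℕ => Ω × Ω) μ₀
          (fun n : ℕ => Khat.comap (fun h : (i : ↥(Finset.Iic n)) → Ω × Ω => h ⟨n, Finset.mem_Iic.2 le_rfl⟩)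
            (measurable_pi_apply _))) ≤
      ∫ y, (f y - ∫ x, f x ∂(q.withDensity fun y => ENNReal.ofReal (w y))) ^ 2
          ∂(q.withDensity fun y => ENNReal.ofReal (w y)) +
        (1 - (w x₀)⁻¹) ^ k * (c - a) ^ 2 * (2 * w x₀ ^ 2 + w x₀ + 1) := by
  have hW : 1 ≤ w x₀ := one_le_of_mode (q := q) hmax
  have hr0 : 0 ≤ 1 - (w x₀)⁻¹ := sub_nonneg.2 (inv_le_one_of_one_le₀ hW)
  have hB0 : 0 ≤ ∫ y, (f y - ∫ x, f x ∂(q.withDensity fun y => ENNReal.ofReal (w y))) ^ 2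
      ∂(q.withDensity fun y => ENNReal.ofReal (w y)) +
      (1 - (w x₀)⁻¹) ^ k * (c - a) ^ 2 * (2 * w x₀ ^ 2 + w x₀ + 1) := by
    have : 0 ≤ ∫ y, (f y - ∫ x, f x ∂(q.withDensity fun y => ENNReal.ofReal (w y))) ^ 2
        ∂(q.withDensity fun y => ENNReal.ofReal (w y)) := integral_nonneg fun y => sq_nonneg _
    positivity
  have hI := crnLag_untruncated_sq_integrable hw0 hmax Khat hK μ₀ hf ha hc k
  have hL := crnLag_untruncated_lintegral_sq_le hw0 hmax Khat hK μ₀ hf ha hc k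
  rw [integral_eq_lintegral_of_nonneg_ae (ae_of_all _ fun z => sq_nonneg _) hI.aestronglyMeasurable]
  exact (ENNReal.toReal_mono ENNReal.ofReal_ne_top hL).trans_eq (ENNReal.toReal_ofReal hB0)

/-- **THE EXACTLY UNBIASED ESTIMATOR HAS FINITE VARIANCE `≤ Var_π f + r^k(c − a)²(2W² + W + 1)`**: under the lag condition
`μ̂₀∘fst⁻¹ = μ₂K` (first run one update ahead) `E H_k = π f` exactly (GEN-36), so the bound of `crnLag_untruncated_sq_le` is a
bound on `Var(H_k) = E(H_k − E H_k)²`. [ours] -/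
theorem crnLag_untruncated_variance_le [MeasurableEq Ω] [Fact (Measurable w)] (hw0 : ∀ y, 0 < w y) {x₀ : Ω}
    (hmax : ∀ y, w y ≤ w x₀) [IsProbabilityMeasure (q.withDensity fun y => ENNReal.ofReal (w y))]
    (Khat : Kernel (Ω × Ω) (Ω × Ω)) [IsMarkovKernel Khat]
    (hK : ∀ z : Ω × Ω, Khat z = (q.prod (volume : Measure unitInterval)).map (fun p : Ω × unitInterval =>
      ((if (p.2 : ℝ) * w z.1 ≤ w p.1 then p.1 else z.1), (if (p.2 : ℝ) * w z.2 ≤ w p.1 then p.1 else z.2))))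
    (μ₀ : Measure (Ω × Ω)) [IsProbabilityMeasure μ₀]
    (hlag : μ₀.map Prod.fst = (μ₀.map Prod.snd).bind (indepMH q w)) {f : Ω → ℝ} (hf : Measurable f) {a c : ℝ}
    (ha : ∀ x, a ≤ f x) (hc : ∀ x, f x ≤ c) (k : ℕ) :
    ∫ z, (f ((z k).2) + ∑' n, (f ((z (k + n)).1) - f ((z (k + n)).2)) -
          (∫ z, f ((z k).2) ∂(Kernel.trajMeasure (X := fun _ : ℕ => Ω × Ω) μ₀
              (fun n : ℕ => Khat.comap (fun h : (i : ↥(Finset.Iic n)) → Ω × Ω => h ⟨n, Finset.mem_Iic.2 le_rfl⟩)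
                (measurable_pi_apply _))) +
            ∫ z, (∑' n : ℕ, (f ((z (k + n)).1) - f ((z (k + n)).2)))
              ∂(Kernel.trajMeasure (X := fun _ : ℕ => Ω × Ω) μ₀
                (fun n : ℕ => Khat.comap (fun h : (i : ↥(Finset.Iic n)) → Ω × Ω => h ⟨n, Finset.mem_Iic.2 le_rfl⟩)
                  (measurable_pi_apply _))))) ^ 2
        ∂(Kernel.trajMeasure (X := fun _ : ℕ => Ω × Ω) μ₀
          (fun n : ℕ => Khat.comap (fun h : (i : ↥(Finset.Iic n)) → Ω × Ω => h ⟨n, Finset.mem_Iic.2 le_rfl⟩)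
            (measurable_pi_apply _))) ≤
      ∫ y, (f y - ∫ x, f x ∂(q.withDensity fun y => ENNReal.ofReal (w y))) ^ 2
          ∂(q.withDensity fun y => ENNReal.ofReal (w y)) +
        (1 - (w x₀)⁻¹) ^ k * (c - a) ^ 2 * (2 * w x₀ ^ 2 + w x₀ + 1) := by
  rw [crnLag_unbiased hw0 hmax Khat hK μ₀ hlag hf ha hc k]
  exact crnLag_untruncated_sq_le hw0 hmax Khat hK μ₀ hf ha hc k

/-- **THE UNTRUNCATED ESTIMATOR IS IN `L²`** of the pair path law, from every initial coupling. [ours] -/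
theorem crnLag_untruncated_memLp_two [MeasurableEq Ω] [Fact (Measurable w)] (hw0 : ∀ y, 0 < w y) {x₀ : Ω}
    (hmax : ∀ y, w y ≤ w x₀) [IsProbabilityMeasure (q.withDensity fun y => ENNReal.ofReal (w y))]
    (Khat : Kernel (Ω × Ω) (Ω × Ω)) [IsMarkovKernel Khat]
    (hK : ∀ z : Ω × Ω, Khat z = (q.prod (volume : Measure unitInterval)).map (fun p : Ω × unitInterval =>
      ((if (p.2 : ℝ) * w z.1 ≤ w p.1 then p.1 else z.1), (if (p.2 : ℝ) * w z.2 ≤ w p.1 then p.1 else z.2))))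
    (μ₀ : Measure (Ω × Ω)) [IsProbabilityMeasure μ₀] {f : Ω → ℝ} (hf : Measurable f) {a c : ℝ}
    (ha : ∀ x, a ≤ f x) (hc : ∀ x, f x ≤ c) (k : ℕ) :
    MemLp (fun z : ℕ → Ω × Ω => f ((z k).2) + ∑' n, (f ((z (k + n)).1) - f ((z (k + n)).2))) 2
      (Kernel.trajMeasure (X := fun _ : ℕ => Ω × Ω) μ₀
        (fun n : ℕ => Khat.comap (fun h : (i : ↥(Finset.Iic n)) → Ω × Ω => h ⟨n, Finset.mem_Iic.2 le_rfl⟩)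
          (measurable_pi_apply _))) := by
  set P := Kernel.trajMeasure (X := fun _ : ℕ => Ω × Ω) μ₀
      (fun n : ℕ => Khat.comap (fun h : (i : ↥(Finset.Iic n)) → Ω × Ω => h ⟨n, Finset.mem_Iic.2 le_rfl⟩)
        (measurable_pi_apply _)) with hP
  set m := ∫ x, f x ∂(q.withDensity fun y => ENNReal.ofReal (w y)) with hm
  have hw : Measurable w := Fact.out
  have hasm := crnLag_untruncated_aestronglyMeasurable hw hw0 hmax Khat hK μ₀ hf k
  rw [← hP] at hasm
  have hI := crnLag_untruncated_sq_integrable hw0 hmax Khat hK μ₀ hf ha hc k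
  rw [← hP] at hI
  have hcentred : MemLp (fun z : ℕ → Ω × Ω => f ((z k).2) + ∑' n, (f ((z (k + n)).1) - f ((z (k + n)).2)) - m) 2 P :=
    (memLp_two_iff_integrable_sq (hasm.sub aestronglyMeasurable_const)).2 hI
  have h := hcentred.add (memLp_const m)
  refine h.congr_norm hasm (ae_of_all _ fun z => ?_)  -- same function up to `+ m − m`
  simp only [Pi.add_apply, sub_add_cancel]

end Summit.Ventures.LatticeQCDFlow.Exactness

end
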